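import Summits.ABC.ABC.Theses.DefiniteXi
import Summits.ABC.ABC.Theorems.DefiniteXiDefiniteRTControlPrime
import Literature.NumberTheory.EllipticCurves.KenkuMinimalLevelsKleinFricke
import Summits.ABC.ABC.Theorems.DefiniteXiDefiniteRTControlPrimeValTransport
import Summits.ABC.ABC.Theorems.KenkuLevelTwentySixRankZero
import Summits.ABC.ABC.Theorems.IsogenyGlueCongruenceKenkuLevelFortyNine
import Summits.ABC.ABC.Theorems.IsogenyGlueCongruenceMazurKenkuBoundLevelThirtyTwo
import Summits.ABC.ABC.Theorems.IsogenyGlueCongruenceMazurKenkuBoundLevelTwenty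
import Literature.NumberTheory.EllipticCurves.RationalTwoTorsionModPIrreducibleProofs
import Literature.NumberTheory.EllipticCurves.MazurTorsionPrimeCaseFromCor44Proofs
import Literature.NumberTheory.EllipticCurves.Rank1Residual.GVParityTwistTransportProofs
import Literature.NumberTheory.EllipticCurves.PastenHeightBoundsLemma68Proofs
import Literature.NumberTheory.EllipticCurves.KleinFrickeLevelThirteen
import HarnessLib

/-!
# Stub-ideation k=1 (gen 4) for `stub_pasten163` — crux `DefiniteRTControlPrime`, route DefiniteXi

HOME FAMILY 1 — RECOGNISE & IMPORT. Scratch check that the helper statements of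
`STUB-IDEAS-stub_pasten163-1.md` (gen 4) elaborate. Gen 4 adds, over gen 1–3 of this ideator
(`STUB_IDEAS_stub_pasten163_1.lean`, `…_1g2.lean`, `…_1g3.lean`; NOT imported — crux-dir modules are
not built on the farm, so gen-3's H1/H2′ are cited by name only):

**Plan A′ — the FREY INSTANCE of the `163`-fact from Mazur's Cor. 4.4 alone.** The crux hands the
skeleton an ODD prime `q ∣ N`, i.e. an odd place of multiplicative reduction of every curve of the
Frey class (`hasMultiplicativeReductionAt_freyCurve_of_ne_two`, `hasMultiplicativeReductionAt_of_isIsogenous`),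
i.e. `ord_v j < 0` at an odd place (`one_lt_valuation_j_of_hasMultiplicativeReduction_localMinimalModel`).
That single fact is the NEGATION of the conclusion of Cor. 4.4 (`Mazur1978.cor44_valuation_j_le_one`,
item stmt-ABC-18223) and of every row of the ten `j`-tables at odd places (all table `j`'s have
`2`-power denominators), so inside a Frey class:
* primes `p = 11`, `p ≥ 17` divide no cyclic degree — Cor. 4.4 ALONE (A′1; the isogeny analogue of
  the landed torsion lemma `Mazur1978.valuation_j_le_one_of_addOrderOf_eq`), no Prop. 5.1, no tables;
* `5` and `13` divide no cyclic degree — full rational `2`-torsion of the Frey curve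
  (`smul_eq_of_two_nsmul_eq_zero_freyCurve`, landed) lifts a stable `p`-line to a cyclic `4p`-isogeny
  (A′2 = the landed Darmon–Merel proof `hasIrreducibleModPGaloisRep_of_rational_two_torsion_of_mazurKenku`
  re-cut to end at the `4p`-isogeny instead of at the Mazur–Kenku fact), and the levels `20`
  (landed, `isogeny_isCyclic_degree_ne_twenty_holds`) and `52 ⊇ 26` (landed modulo the cite-only
  Klein–Fricke `13`, `isCyclic_degree_ne_twentySix`) are excluded;
* `32 ∤ d`, `49 ∤ d` (landed levels), `27 ∤ d` (the one-row `j`-table of `X₀(27)`: `j = -2¹⁵·3·5³`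
  is integral — against `ord_q j < 0`).
Hence every cyclic `ℚ`-isogeny inside the class of a Frey curve with an odd bad prime has degree
`d ∣ 2⁴·3²·7 = 1008` (A′4), and gen-3's H1 (`163 ↦ 1008`) / H2′ replace BOTH Pasten stubs: the crux
holds modulo `{Takahashi, Cor. 4.4, Klein–Fricke 13, table(27)}` — item stmt-ABC-18224 (seven prime
`j`-tables + levels `65, 125, 169`) leaves the cone of stmt-ABC-11338.

`sorry` only inside helper bodies marked S/M; the XS glue is proved.
-/

-- `Summit.ABC.ABC` is the mandated summit-side namespace; the duplicate is deliberate.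
set_option linter.dupNamespace false
set_option linter.unusedSimpArgs false

namespace Summit.ABC.ABC.Cruxes.DefiniteRTControlPrime.Sketch.Ideas1g4

open Summit.ABC.ABC.Theses.DefiniteXi
open Literature.NumberTheory.EllipticCurves Literature.NumberTheory.EllipticCurves.ModularForms
open Literature.NumberTheory.GaloisRepresentations
open Literature.NumberTheory.DiophantineGeometry
open WeierstrassCurve IsDedekindDomain NumberField Field

/-! ## A′1 — Cor. 4.4 kills the primes `11` and `≥ 17` in a class with an odd multiplicative place -/

/-- **A′1a** (S; the body of the landed `mem_mazurPrimes_of_prime_dvd_degree` with the fact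
`mazur_isogeny_irreducible` replaced by the assumption to be refuted): a prime dividing the degree of
a CYCLIC `ℚ`-isogeny out of `W` makes `ρ̄_{W,p}` reducible (`H = W[p] ∩ ker φ` is a stable line:
`≠ 0` by Cauchy in the cyclic kernel, `≠ W[p]` since `W[p]` is not cyclic).
[cite: SilvermanAEC2009, Prop. III.4.12] -/
theorem not_hasIrreducibleModPGaloisRep_of_prime_dvd_degree {W W' : WeierstrassCurve ℚ}
    [W.IsElliptic] [W'.IsElliptic] (φ : Isogeny W W') (hφ : φ.IsCyclic) {p : ℕ} (hp : p.Prime)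
    (hpd : p ∣ φ.degree) : ¬ W.HasIrreducibleModPGaloisRep p := by
  sorry

/-- **A′1** (S; ISOGENY ANALOGUE of the landed torsion lemma
`Mazur1978.valuation_j_le_one_of_addOrderOf_eq`): granted Cor. 4.4, a curve with a cyclic
`ℚ`-isogeny of degree divisible by a prime `p ∉ {2,3,5,7,13}` has `ord_v j ≥ 0` at every odd place.
Assembly: A′1a, `Mazur1978.not_hasIrreducibleModPGaloisRep_iff_exists_natCard_eq`,
`Mazur1978.eq_eleven_or_seventeen_le_of_not_mem`, `h44`. [cite: Mazur1978, Cor. 4.4 (p. 145)] -/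
theorem valuation_j_le_one_of_prime_dvd_degree (h44 : Mazur1978.cor44_valuation_j_le_one)
    {W W' : WeierstrassCurve ℚ} [W.IsElliptic] [W'.IsElliptic] (φ : Isogeny W W')
    (hφ : φ.IsCyclic) {p : ℕ} (hp : p.Prime) (hpd : p ∣ φ.degree)
    (hpS : p ∉ ({2, 3, 5, 7, 13} : Finset ℕ)) (v : HeightOneSpectrum (𝓞 ℚ))
    (hv : (2 : 𝓞 ℚ) ∉ v.asIdeal) : v.valuation ℚ W.j ≤ 1 := by
  haveI : Fact p.Prime := ⟨hp⟩
  haveI : NeZero (p : ℚ) := ⟨Nat.cast_ne_zero.mpr hp.ne_zero⟩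
  exact h44 W p (Mazur1978.eq_eleven_or_seventeen_le_of_not_mem hp hpS)
    ((Mazur1978.not_hasIrreducibleModPGaloisRep_iff_exists_natCard_eq W p).mp
      (not_hasIrreducibleModPGaloisRep_of_prime_dvd_degree φ hφ hp hpd)) v hv

/-- **A′1c** (XS, proved; the form the assembly uses): at an odd MULTIPLICATIVE place, Cor. 4.4
forbids every prime `p ∉ {2,3,5,7,13}` in the degree of a cyclic isogeny out of `W`
(*AEC* VII.5.1(b): `one_lt_valuation_j_of_hasMultiplicativeReduction_localMinimalModel`).
[cite: Mazur1978, Cor. 4.4 (p. 145)] [cite: SilvermanAEC2009, Prop. VII.5.1(b)] -/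
theorem not_prime_dvd_degree_of_cor44 (h44 : Mazur1978.cor44_valuation_j_le_one)
    {W W' : WeierstrassCurve ℚ} [W.IsElliptic] [W'.IsElliptic] (φ : Isogeny W W')
    (hφ : φ.IsCyclic) {p : ℕ} (hp : p.Prime) (hpS : p ∉ ({2, 3, 5, 7, 13} : Finset ℕ))
    (v : HeightOneSpectrum (𝓞 ℚ)) (hv : (2 : 𝓞 ℚ) ∉ v.asIdeal)
    (hm : W.HasMultiplicativeReductionAt v) : ¬ p ∣ φ.degree := fun hpd ↦
  (one_lt_valuation_j_of_hasMultiplicativeReduction_localMinimalModel v W hm).not_ge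
    (valuation_j_le_one_of_prime_dvd_degree h44 φ hφ hp hpd hpS v hv)

/-! ## A′2 — full rational `2`-torsion lifts a stable `p`-line to a cyclic `4p`-isogeny -/

/-- **A′2** (S–M; RE-CUT of the landed 290-line proof of
`hasIrreducibleModPGaloisRep_of_rational_two_torsion_of_mazurKenku`, Steps 1–4 and the first line
of Step 5 verbatim — they build `g₂ : E₁ → E₂`, `E₁ = W/⟨Q⟩`, with CYCLIC kernel `⟨g₁ R + g₁ s₀⟩` of
order `4p` — then `exact hlev E₁ E₂ g₂ ‹cyclic› ‹degree = 4p›` in place of the Mazur–Kenku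
paragraph; `5 ≤ p` was used only in the Kenku arithmetic, `p` odd suffices).
[cite: DarmonMerel1997, Thm. 2.2 with Lemma 1.2 (1)] [cite: Kenku1982, Thm. 1] -/
theorem hasIrreducibleModPGaloisRep_of_rational_two_torsion_of_level (W : WeierstrassCurve ℚ)
    [W.IsElliptic] (h2 : ∀ (σ : absoluteGaloisGroup ℚ) (P : W.geomPoints), 2 • P = 0 → σ • P = P)
    {p : ℕ} (hp : p.Prime) (hp2 : p ≠ 2)
    (hlev : ∀ (V V' : WeierstrassCurve ℚ) [V.IsElliptic] [V'.IsElliptic] (ψ : Isogeny V V'),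
      ψ.IsCyclic → ψ.degree ≠ 4 * p) :
    W.HasIrreducibleModPGaloisRep p := by
  sorry

/-! ## A′3 — the two levels `4p` that are theorems of the tree: `20` and `52 ⊇ 26` -/

/-- **A′3(5)** (XS, proved): level `20 = 4·5` is the landed `isogeny_isCyclic_degree_ne_twenty_holds`.
[cite: Kenku1982, Thm. 1] -/
theorem isCyclic_degree_ne_four_mul_five (V V' : WeierstrassCurve ℚ) [V.IsElliptic] [V'.IsElliptic]
    (ψ : Isogeny V V') (hψ : ψ.IsCyclic) : ψ.degree ≠ 4 * 5 :=
  Summit.ABC.ABC.Theorems.isogeny_isCyclic_degree_ne_twenty_holds V V' ψ hψ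

/-- **A′3(13)** (XS, proved): level `52 = 4·13` from the level `26` (landed modulo the cite-only
Klein–Fricke parametrisation at `13`, `isCyclic_degree_ne_twentySix`) through the cyclic
sub-isogeny of degree `26` (`Isogeny.exists_isCyclic_degree_eq_of_dvd`).
[cite: Kenku1982, Thm. 1] [cite: Barrios2022IsogenyGraphs, Thm 2.3 + Table 1 (n = 13)] -/
theorem isCyclic_degree_ne_four_mul_thirteen (h13 : kleinFrickeThirteen_exists_j_eq)
    (V V' : WeierstrassCurve ℚ) [V.IsElliptic] [V'.IsElliptic] (ψ : Isogeny V V')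
    (hψ : ψ.IsCyclic) : ψ.degree ≠ 4 * 13 := by
  intro h
  obtain ⟨V'', hV'', χ, hχ, hdeg, -⟩ :=
    ψ.exists_isCyclic_degree_eq_of_dvd hψ (show 26 ∣ ψ.degree by rw [h]; norm_num)
  haveI := hV''
  exact Summit.ABC.ABC.Theorems.isCyclic_degree_ne_twentySix h13 V V'' χ hχ hdeg

/-- **Darmon–Merel for the Frey curve at `5`, UNCONDITIONALLY** (XS given A′2): no Frey–Hellegouarch
curve has a rational `5`-isogeny — Mazur-free (full `2`-torsion + level `20`).
[cite: DarmonMerel1997, Thm. 2.2] -/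
theorem hasIrreducibleModPGaloisRep_freyCurve_five {a b : ℤ} (h0 : a * b * (a + b) ≠ 0) :
    haveI := isElliptic_freyCurve h0
    (freyCurve a b).HasIrreducibleModPGaloisRep 5 := by
  haveI := isElliptic_freyCurve h0
  exact hasIrreducibleModPGaloisRep_of_rational_two_torsion_of_level (freyCurve a b)
    (fun σ _ hT ↦ smul_eq_of_two_nsmul_eq_zero_freyCurve h0 σ hT) (by norm_num) (by norm_num)
    isCyclic_degree_ne_four_mul_five

/-- The same at `13`, modulo Klein–Fricke `13` only. [cite: DarmonMerel1997, Thm. 2.2] -/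
theorem hasIrreducibleModPGaloisRep_freyCurve_thirteen (h13 : kleinFrickeThirteen_exists_j_eq)
    {a b : ℤ} (h0 : a * b * (a + b) ≠ 0) :
    haveI := isElliptic_freyCurve h0
    (freyCurve a b).HasIrreducibleModPGaloisRep 13 := by
  haveI := isElliptic_freyCurve h0
  exact hasIrreducibleModPGaloisRep_of_rational_two_torsion_of_level (freyCurve a b)
    (fun σ _ hT ↦ smul_eq_of_two_nsmul_eq_zero_freyCurve h0 σ hT) (by norm_num) (by norm_num)
    (isCyclic_degree_ne_four_mul_thirteen h13)

/-! ## A′4 — the Frey-class cyclic diameter `d ∣ 1008` -/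

/-- **A′4ar** (S, arithmetic): prime support `⊆ {2,3,7}` with `32, 27, 49 ∤ d` means `d ∣ 2⁴·3²·7`.
[folklore] -/
theorem dvd_1008_of_primeFactors {d : ℕ} (hd : 0 < d)
    (hsupp : ∀ p : ℕ, p.Prime → p ∣ d → p = 2 ∨ p = 3 ∨ p = 7)
    (h32 : ¬ 32 ∣ d) (h27 : ¬ 27 ∣ d) (h49 : ¬ 49 ∣ d) : d ∣ 1008 := by
  sorry

/-- **A′4** (M, the assembly of Plan A′): inside the `ℚ`-isogeny class of a Frey curve with an ODD
bad prime `q`, every cyclic `ℚ`-isogeny has degree `d ∣ 1008 = 2⁴·3²·7`. For each prime `p ∣ d`: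
cyclic sub-isogeny of degree `p` out of `W₁` (`Isogeny.exists_isCyclic_degree_eq_of_dvd`); `W₁`
multiplicative at the place of `𝓞 ℚ` over `q` (`hasMultiplicativeReductionAt_freyCurve_of_ne_two`,
`hasMultiplicativeReductionAt_of_isIsogenous`, bridge `conductorExponent_eq_of_primesEquiv_eq` /
`conductorExponent_eq_one_iff_holds` as in the proof of the latter); A′1c ⇒ `p ∈ {2,3,5,7,13}`;
`p = 5, 13`: reducibility transported to the Frey curve
(`Rank1Residual.not_hasIrreducibleModPGaloisRep_of_isIsogenous`) contradicts
`hasIrreducibleModPGaloisRep_freyCurve_five` / `…_thirteen h13`; `32 ∤ d`, `49 ∤ d`: gen-1 H3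
(`not_thirtyTwo_dvd_degree_of_isCyclic`) and its twin over `isogeny_isCyclic_degree_ne_fortyNine`;
`27 ∤ d`: the sub-isogeny of degree `27` has `j(W₁) = -12288000 ∈ ℤ` by `hT27`, against
`1 < |j(W₁)|_v`. Then A′4ar. [cite: Mazur1978, Cor. 4.4] [cite: Kenku1982, Thm. 1 (p. 199)]
[cite: Ligozat1975] -/
theorem frey_isCyclic_degree_dvd (h44 : Mazur1978.cor44_valuation_j_le_one)
    (h13 : kleinFrickeThirteen_exists_j_eq)
    (hT27 : ∀ (V V' : WeierstrassCurve ℚ) [V.IsElliptic] [V'.IsElliptic] (ψ : Isogeny V V'),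
      ψ.IsCyclic → ψ.degree = 27 → V.j = -12288000)
    {a b : ℤ} (hab : IsCoprime a b) (h0 : a * b * (a + b) ≠ 0) {q : ℕ} (hq : q.Prime)
    (hq2 : q ≠ 2) (hqN : q ∣ (freyCurve a b).conductorNorm ℤ)
    (W₁ W₂ : WeierstrassCurve ℚ) [W₁.IsElliptic] [W₂.IsElliptic]
    (h₁ : (freyCurve a b).IsIsogenous W₁) (φ : Isogeny W₁ W₂) (hφ : φ.IsCyclic) :
    φ.degree ∣ 1008 := by
  sorry

/-- `hT27` is literally the level-`27` row of the tree's table schema `kenkuIsogenyJTable`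
(hypothesis `hT` of the landed lite closers): XS, proved. [cite: Ligozat1975]
[cite: Kenku1982, proof of Thm. 1, p. 200] -/
theorem hT27_of_jTables
    (hT : ∀ (V V' : WeierstrassCurve ℚ) [V.IsElliptic] [V'.IsElliptic] (ψ : Isogeny V V'),
      ψ.IsCyclic → ψ.degree ∈ ({11, 15, 17, 19, 21, 27, 37, 43, 67, 163} : Finset ℕ) →
        (ψ.degree, V.j) ∈ kenkuIsogenyJTable)
    (V V' : WeierstrassCurve ℚ) [V.IsElliptic] [V'.IsElliptic] (ψ : Isogeny V V')
    (hψ : ψ.IsCyclic) (hdeg : ψ.degree = 27) : V.j = -12288000 := by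
  have h := hT V V' ψ hψ (by rw [hdeg]; decide)
  rw [hdeg] at h
  have key : ∀ x : ℚ, ((27 : ℕ), x) ∈ kenkuIsogenyJTable → x = -12288000 := by
    intro x hx
    simp only [kenkuIsogenyJTable, Finset.mem_insert, Finset.mem_singleton, Prod.mk.injEq] at hx
    rcases hx with ⟨h, _⟩ | ⟨h, _⟩ | ⟨h, _⟩ | ⟨h, _⟩ | ⟨h, _⟩ | ⟨h, _⟩ | ⟨h, _⟩ | ⟨h, _⟩ | ⟨h, _⟩ |
      ⟨h, _⟩ | ⟨h, _⟩ | ⟨h, _⟩ | ⟨h, _⟩ | ⟨h, _⟩ | ⟨h, _⟩ | ⟨h, _⟩ | ⟨_, hx⟩ | ⟨h, _⟩ | ⟨h, _⟩ |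
      ⟨h, _⟩ | ⟨h, _⟩ | ⟨h, _⟩ <;> first | exact hx | (exfalso; omega)
  exact key V.j h

/-! ## A′5 — composition: a constant cyclic diameter on Frey classes with an odd bad prime ⇒ crux -/

/-- The ODD-prime-restricted, CONSTANT form of gen-1's `FreyIsogenyDiameter` (the only instances
the skeleton ever uses: it is handed `q ∣ N`, `q ≠ 2`). -/
def FreyIsogenyDiameterOdd (B : ℕ) : Prop :=
  ∀ a b : ℤ, IsCoprime a b → a * b * (a + b) ≠ 0 →
    ∀ q : ℕ, q.Prime → q ≠ 2 → q ∣ (freyCurve a b).conductorNorm ℤ →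
      ∀ (W₁ W₂ : WeierstrassCurve ℚ) [W₁.IsElliptic] [W₂.IsElliptic],
        (freyCurve a b).IsIsogenous W₁ → ∀ φ : Isogeny W₁ W₂, φ.IsCyclic → φ.degree ≤ B

/-- **A′5b** (XS, proved): Plan A′'s inputs give the diameter `1008`. -/
theorem freyIsogenyDiameterOdd_of_cor44 (h44 : Mazur1978.cor44_valuation_j_le_one)
    (h13 : kleinFrickeThirteen_exists_j_eq)
    (hT27 : ∀ (V V' : WeierstrassCurve ℚ) [V.IsElliptic] [V'.IsElliptic] (ψ : Isogeny V V'),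
      ψ.IsCyclic → ψ.degree = 27 → V.j = -12288000) :
    FreyIsogenyDiameterOdd 1008 :=
  fun _ _ hab h0 _ hq hq2 hqN W₁ W₂ _ _ h₁ φ hφ ↦
    Nat.le_of_dvd (by norm_num) (frey_isCyclic_degree_dvd h44 h13 hT27 hab h0 hq hq2 hqN W₁ W₂ h₁ φ hφ)

/-- **A′5a** (S–M; the lead's `DefiniteRTControlPrime_of` re-plumbed, PLAN-INDEPENDENT): a constant
cyclic diameter `B` on Frey classes with an odd bad prime replaces BOTH Pasten stubs — `h163` by
gen-3's H1 `modularDegree_le_mul_of_cyclicDiameter B` at the minimal model `W_m = C • freyCurve a b`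
(its class is the Frey class: `exists_variableChange_isogeny`), `hval` by gen-3's H2′
`ordMinimalDiscriminant_le_mul_of_isCyclic` at the place over `q` along a CYCLIC `freyCurve a b → W⋆`
(`IsIsogenous.exists_isCyclic`; both multiplicative there); Takahashi twice as in the skeleton;
constant `C = 4·B²`. Remaining debt under it: gen-3's H1a (S–M) and H1b (M).
[cite: PastenShimura2024, §3 p. 13 and Lemma 6.8 (p. 22)] [cite: Takahashi2001, Thm. 2.3] -/
theorem definiteRTControlPrime_of_oddDiameter (hT : takahashi2001_thm_2_3_of_coprime) {B : ℕ}
    (hDiam : FreyIsogenyDiameterOdd B) : DefiniteRTControlPrime := by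
  sorry

/-- **Plan A′, assembled** (XS): the crux modulo `{Takahashi, Cor. 4.4, Klein–Fricke 13, table(27)}`
— compare the current closer `definiteRTControlPrime_of_facts ∘ stub_pasten163_of_cor44_of_jTables_of_liteLevels6`,
modulo `{Takahashi, Cor. 4.4, TEN tables, levels 26, 65, 125, 169, Lemma 6.8-inputs}`. -/
theorem definiteRTControlPrime_of_cor44 (hT : takahashi2001_thm_2_3_of_coprime)
    (h44 : Mazur1978.cor44_valuation_j_le_one) (h13 : kleinFrickeThirteen_exists_j_eq)
    (hT27 : ∀ (V V' : WeierstrassCurve ℚ) [V.IsElliptic] [V'.IsElliptic] (ψ : Isogeny V V'),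
      ψ.IsCyclic → ψ.degree = 27 → V.j = -12288000) :
    DefiniteRTControlPrime :=
  definiteRTControlPrime_of_oddDiameter hT (freyIsogenyDiameterOdd_of_cor44 h44 h13 hT27)

end Summit.ABC.ABC.Cruxes.DefiniteRTControlPrime.Sketch.Ideas1g4
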